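import Mathlib
import Literature.MathematicalPhysics.QuantumFieldTheory.Balaban1983to89.B12Decay510Lattice
import Literature.MathematicalPhysics.QuantumFieldTheory.Balaban1983to89.TreeLengthTorus

/-!
# Bałaban, *Renormalization Group Approach to Lattice Gauge Field Theories. I* (CMP 109, 1987) — (5.10) p. 293
on the PERIODIC CARRIER OF PRINT: sites = the points of the torus T₁ (N·M per direction), cubes of side M indexed
by (ℤ/N)^d, localization domains and d_j those of `TreeLengthTorus` (the geometric leaves of `B12Decay510`
discharged on the torus; cell DIVERGENCE D-b03.11 (ii) "window instead of torus" removed for (5.10))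

CITATION HEADER (lean-in-tree rule 2026-08-18).  Source under audit: T. Bałaban, Commun. Math. Phys. **109** (1987)
249–301 [Balaban1987RG1] (= "B12" of the cell census; p. 251 = PDF 3, p. 257 = PDF 9, p. 282 = PDF 34,
p. 292 = PDF 44, p. 293 = PDF 45); lattice sums of T. Bałaban, Commun. Math. Phys. **116** (1988) 1–22
[Balaban1988RG2Cluster] (= "B13"; (1.26) p. 8).  NOTHING IS QUOTED AFRESH: every printed fragment below is the
certified wording carried by the docstrings of the imported modules `…Balaban1983to89.TreeLengthTorus` (unit pv22
gen 2: the torus sentence p. 251, the cubes / connected families / d_j sentences p. 257, (0.26); cross-read GAPS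
C-pv22-4) and `…Balaban1983to89.B12Decay510` / `…B12Decay510Window` / `…B12Decay510Lattice` (unit b03 gens 3–4:
(5.10) p. 293 with its δ₁ example, (5.1) p. 292, (4.35) p. 290, the p. 282 B₃-sentence, (1.18); cross-reads
GAPS C-pv13g2-2, C-pv13g2-5, C-pv13g2-7, C-pv14-25, C-pv27-2).  Unit `b2b-balaban-beta-an4-g8` (DEDICATED β sub-cell, row BETA-an4 gen 8, journal
claim AN4-CHAIN-TORUS (1)); consumer: `…Balaban1983to89.Beta.RemainderChainTorus` (same claim, (2)).  Companion
modules (all imported or siblings, NONE modified): `…B12Decay510` (b03 gen 3: (5.10) kernel-derived from NAMED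
LEAVES over an abstract `SiteGeometry C Λ`), `…B12Decay510Window` (the leaves for the WINDOW system with a site
identified with its cube), `…B12Decay510Lattice` (b03 gen 4: sites = ℤ^d, cubes of side M — D-b03.11 (i)
repaired — still on windows), `…TreeLengthTorus` (pv22 gen 2: the periodic cube system `tcubeSys d N`, torus
localization domains `TDom d N`, d_j := `torusTreeLen`, the degree bound `tdegreeLE` and the volume leaf
`tvolumeLeaf` PROVED on the torus).

HONEST FRAMING (cell charter, verbatim): "discharging BetaPertH makes Balaban's UV stability UNCONDITIONAL — a real
constructive-QFT result; it is NOT the continuum limit and NOT the Clay problem."  This module is KERNEL BOOKKEEPING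
of lattice geometry ([folklore] real/integer arithmetic on (ℤ/T)^d); it discharges no analytic hypothesis of B12 and
is NOT summit progress.  ABSOLUTE RULE (verbatim): "No internally-minted statement may enter as a cited fact. Every
hypothesis is either kernel-proved in this package or a verbatim quotation of a PUBLISHED theorem with page
reference."  No `def … : Prop` fact is introduced here; every declaration is a definition or a proved theorem.

WHAT THE PAPER PRINTS (certified wordings of the imported modules; nothing else is attributed to it).  p. 251:
*"a torus T obtained by the usual identification of boundary points of the cube {x ∈ R^d : −L_μ ≦ x_μ ≦ L_μ,
μ = 1, …, d}"* (lattice approximations (0.1)).  p. 257: *"We decompose the space T into the lattice of closed cubes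
of a size M, where M = L^m, with centers at points of the lattice T_M^{(j+m)}. … We denote this family of cubes by
π_j"*; *"A length of a shortest graph in this class, divided by M, is the linear size of X, and is denoted by
d_j(X)."*  p. 282: *"… and if one of the functions B_i is localized outside the domain X, then we have the
additional exponential factor exp(−δ₀dist^{(ξ)}(X, supp B_i))."*  p. 292 (5.1): *"it can be defined also as
Π(b, b′) = lim_{T₁^{(j)}↗Z⁴} (δ²/δB(b)δB(b′)) 𝐄^{(j)}(U_j(exp iB))∣_{B=0}."*  p. 293: *"The representation (4.37)
yields the following inequality ∣Π_{μν}(x − y)∣ ≤ O(1)E₀ exp(−δ₁∣x − y∣), (5.10) with a positive constant δ₁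
determined by δ₀, κ, and M (e.g., δ₁ = 1/2min{δ₀, κM⁻¹})."*

## What this module does

The sites of (5.10) live on the torus T₁^{(j)} of (5.1) BEFORE the limit ↗ Z^d; `B12Decay510Lattice` modelled each
finite system by a WINDOW of cubes B ⊂ ℤ^d with sites ℤ^d (its DIVERGENCE (ii)).  Here the finite system IS a torus:
* Part 1 — one coordinate: the periodic absolute value `pabs a = ∣valMinAbs a∣` on ℤ/T (symmetric, subadditive,
  MINIMAL among integer representatives: `pabs_le_abs_of_cast_eq`; small integers are their own representatives:
  `pabs_intCast_of_two_mul_abs_lt`).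
* Part 2 — sites (ℤ/T)^d (`TreeLengthTorus.TPt`): the periodic ℓ¹ length `pl1` (= `B12Sec2to5.l1` of the vector
  of minimal representatives `vmaVec`), its triangle inequality, `pl1_proj_le_l1` (reduction mod T never
  lengthens) and `pl1_proj_eq_l1` (it is isometric on vectors with 2∣z_i∣ < T).
* Part 3 — the torus with N·M sites per direction: the cube `tcubeOf N M p ∈ (ℤ/N)^d` of a site (⌊·/M⌋ mod N on
  the standard lift; LIFT-INDEPENDENT: `proj_cubeOf_of_proj_eq`), every cube has a site (`tcubeOf_base`), the
  distance `distCT N M p c` from a site to a cube (min over the sites of the cube), the KEY LOWER BOUND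
  `pl1_tcubeOf_sub_le_distCT` (dist(x, □_c) ≥ ∣cube(x) − c∣ on (ℤ/N)^d, uniformly in M), the lift-free diameter
  bound `pabs_sub_le_torusTreeLen` (∣a_i − b_i∣_N ≤ d_j(X̄) + 2 for cubes a, b of a torus domain X̄, from
  `TAdmissible.meets` + `B12Decay510Window.dist_le_len` on the universal cover), the site-level diameter
  `pl1_sub_le_torusTreeLen_sites` (∣p − q∣ ≤ Md(d_j(X̄) + 3), by RE-LIFTING q through the period N·M), and the
  cube sum `sum_exp_distCT_le` (Σ_□ e^{−a·dist(x, □)} ≤ K₁(d, a), the window module's M-uniform constant, via the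
  isometric embedding of (ℤ/N)^d into ℤ^d by minimal representatives).
* Part 4 — the `SiteGeometry` of the torus (`geomT d N M` over `(tcubeSys d N).toCubeCover`) and its three
  leaves PROVED: `geomLeafT` with (M′, c₁) = (M·d, 3), `cubeSumLeafT` with K₁(d, a), `treeLeafT` =
  `B12Decay510.treeLeaf_of_volumeLeaf` on `tdegreeLE`/`tvolumeLeaf` with K₀(4·2^d, 2d) once κ/2 ≥ κ₀(4·2^d, 2d)
  — the SAME numbers as the window/lattice modules.
* Part 5 — (5.10) on one torus, `abs_twoPoint_le_torus`; Part 6 — an exhausting family of tori N_n·M, N_n → ∞,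
  the metric leaf `pl1_proj_zero_sub_proj_eventually` (the embedding z ↦ z mod N_nM of ℤ^d is isometric at
  (0, z) eventually) and `decay510_torus`, landing in `B12Sec2to5.Decay510 P C (delta1 δ₀ κ (M·d))` with
  C = 4E₀α₂⁻²B₃² e^{3Mdδ₁} K₀(4·2ᵈ, 2d) K₁(d, δ₀/2), δ₁ = ½ min{δ₀, κ(Md)⁻¹} — IDENTICAL constants to
  `B12Decay510Lattice.decay510_lattice`, so consumers swap carriers at no cost in the constant table.

## WHAT IS NOT CLAIMED / DIVERGENCE (recorded in the cell file)

(i) The lattice norm of ∣x − y∣ in (5.10) and of dist^{(ξ)}(X, ·) on p. 282 is not fixed by print at these loci;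
as in `B12Decay510Lattice` Part 4 both are read as (periodic) ℓ¹ distances and the printed M of δ₁ then appears as
M·d (the sup reading of `B12Decay510Lattice` Part 5, which shows ½ min{δ₀, κM⁻¹} on the nose on windows, is not
repeated here).  (ii) REMOVED relative to `B12Decay510Lattice`: the finite systems are the tori T₁ of print
(periodic cubes, wrap-around walls, d_j on the torus as in `TreeLengthTorus`), exhausting ℤ^d as N_n → ∞; the
limit (5.1) itself stays the hypothesis `hlim` (its existence is [I] p. 264 / (1.7), not asserted).  (iii) c₁ = 3
as in the lattice module; print displays no c₁.  (iv) The torus of p. 251 has 2L_μ/ξ sites per direction and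
cubes of side M = L^m; here any N ≥ 1 cubes of any side M ≥ 1 per direction (more general).  Every analytic
hypothesis — (4.4) analyticity `han`, (1.18) `h118`, the representation (4.35) `hrepr`, the minimizer decay of
p. 282 / [15] Sect. G `hh`, the limit (5.1) `hlim` — is carried by name exactly as in `B12Decay510Window` /
`B12Decay510Lattice`; nothing of B12's analysis is asserted here.
-/

namespace Literature.MathematicalPhysics.QuantumFieldTheory.Balaban1983to89.B12Decay510Torus

noncomputable section

open Literature.MathematicalPhysics.QuantumFieldTheory.Balaban1983to89
open Literature.MathematicalPhysics.QuantumFieldTheory.Balaban1983to89.B13ScaleTransfer (Pt)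
open Literature.MathematicalPhysics.QuantumFieldTheory.Balaban1983to89.TreeLength
open Literature.MathematicalPhysics.QuantumFieldTheory.Balaban1983to89.TreeLengthTorus
open Literature.MathematicalPhysics.QuantumFieldTheory.Balaban1983to89.B12TreeDecay
open Literature.MathematicalPhysics.QuantumFieldTheory.Balaban1983to89.B12Decay510
open Literature.MathematicalPhysics.QuantumFieldTheory.Balaban1983to89.B12Decay510Window
  (K₁ K₁_nonneg l1_neg l1_sub_comm l1_sub_triangle l1_sub_le_dist dist_le_len)
open Literature.MathematicalPhysics.QuantumFieldTheory.Balaban1983to89.B12Decay510Lattice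
  (clo chi distI cubeOf mem_cube_cubeOf distI_le_abs_sub abs_cubeOf_sub_le_distI l1_sub_le_of_cubeOf)
open Literature.MathematicalPhysics.QuantumFieldTheory.Balaban1983to89.B12Sec2to5 (l1 l1_nonneg)
open Set Metric Filter Topology

variable {d : ℕ}

/-! ## 1. One coordinate: the periodic absolute value ∣a∣_T := ∣valMinAbs a∣ on ℤ/T -/

section OneCoordinate

variable {T : ℕ}

/-- ∣a∣_T: the distance from the residue `a ∈ ℤ/T` to 0 along the cycle — the absolute value of Mathlib's minimal
representative `ZMod.valMinAbs a ∈ ]−T/2, T/2]`. [folklore] -/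
def pabs (a : ZMod T) : ℤ := |a.valMinAbs|

/-- ∣a∣_T = natAbs (valMinAbs a), as an integer. [folklore] -/
theorem pabs_eq_natAbs (a : ZMod T) : pabs a = (a.valMinAbs.natAbs : ℤ) := by
  rw [pabs, Int.natCast_natAbs]

/-- ∣a∣_T ≥ 0. [folklore] -/
theorem pabs_nonneg (a : ZMod T) : 0 ≤ pabs a := abs_nonneg _

/-- ∣0∣_T = 0. [folklore] -/
@[simp] theorem pabs_zero : pabs (0 : ZMod T) = 0 := by
  simp [pabs]

/-- Two integers with the same residue mod T differ by a multiple of T. [folklore] -/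
theorem exists_eq_add_mul_of_cast_eq {x y : ℤ} (h : ((x : ℤ) : ZMod T) = ((y : ℤ) : ZMod T)) :
    ∃ j : ℤ, y = x + j * T := by
  obtain ⟨j, hj⟩ := (ZMod.intCast_eq_intCast_iff_dvd_sub x y T).1 h
  exact ⟨j, by linarith⟩

/-- ∣−a∣_T = ∣a∣_T. [folklore] -/
theorem pabs_neg (a : ZMod T) : pabs (-a) = pabs a := by
  rw [pabs_eq_natAbs, pabs_eq_natAbs, ZMod.natAbs_valMinAbs_neg]

/-- ∣a − b∣_T = ∣b − a∣_T. [folklore] -/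
theorem pabs_sub_comm (a b : ZMod T) : pabs (a - b) = pabs (b - a) := by
  rw [← pabs_neg, neg_sub]

variable [NeZero T]

/-- **Minimality**: every integer representative of the class is at least ∣a∣_T in absolute value. [folklore] -/
theorem pabs_le_abs_of_cast_eq {a : ZMod T} {x : ℤ} (h : (x : ZMod T) = a) : pabs a ≤ |x| := by
  rw [pabs_eq_natAbs, ← Int.natCast_natAbs x]
  exact_mod_cast ZMod.natAbs_min_of_le_div_two T a.valMinAbs x (by rw [ZMod.coe_valMinAbs, h])
    (ZMod.natAbs_valMinAbs_le a)

/-- The periodic absolute value is subadditive. [folklore] -/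
theorem pabs_add_le (a b : ZMod T) : pabs (a + b) ≤ pabs a + pabs b :=
  (pabs_le_abs_of_cast_eq (x := a.valMinAbs + b.valMinAbs) (by push_cast; simp)).trans (abs_add_le _ _)

/-- **Small integers are their own minimal representative**: valMinAbs (x mod T) = x whenever 2∣x∣ < T. [folklore] -/
theorem valMinAbs_intCast_of_two_mul_abs_lt {x : ℤ} (h : 2 * |x| < T) : ((x : ZMod T)).valMinAbs = x := by
  set v := ((x : ZMod T)).valMinAbs with hv
  have hdvd : (T : ℤ) ∣ x - v := by
    have h1 : ((v : ℤ) : ZMod T) = ((x : ℤ) : ZMod T) := by rw [hv, ZMod.coe_valMinAbs]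
    exact (ZMod.intCast_eq_intCast_iff_dvd_sub v x T).1 h1
  have hle : |v| ≤ |x| := pabs_le_abs_of_cast_eq (a := (x : ZMod T)) (x := x) rfl
  have hlt : |x - v| < T := by
    calc |x - v| ≤ |x| + |v| := abs_sub x v
      _ ≤ 2 * |x| := by linarith
      _ < T := h
  have hlt' : (x - v).natAbs < (T : ℤ).natAbs := by
    have h1 : ((x - v).natAbs : ℤ) < ((T : ℤ).natAbs : ℤ) := by
      rw [Int.natCast_natAbs, Int.natCast_natAbs, Nat.abs_cast]
      exact hlt
    exact_mod_cast h1
  have h0 := Int.eq_zero_of_dvd_of_natAbs_lt_natAbs hdvd hlt'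
  linarith

/-- Hence ∣x mod T∣_T = ∣x∣ whenever 2∣x∣ < T. [folklore] -/
theorem pabs_intCast_of_two_mul_abs_lt {x : ℤ} (h : 2 * |x| < T) : pabs ((x : ZMod T)) = |x| := by
  rw [pabs, valMinAbs_intCast_of_two_mul_abs_lt h]

end OneCoordinate

/-! ## 2. Sites of the torus (ℤ/T)^d and the periodic ℓ¹ distance -/

section Sites

variable {T : ℕ}

/-- The vector of minimal representatives of a point of (ℤ/T)^d. [folklore] -/
def vmaVec (x : TPt d T) : Pt d := fun i => (x i).valMinAbs

/-- `vmaVec` is injective (a residue is determined by its minimal representative). [folklore] -/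
theorem vmaVec_injective : Function.Injective (vmaVec (d := d) (T := T)) := by
  intro x y h
  funext i
  have hi := congrFun h i
  simp only [vmaVec] at hi
  rw [← ZMod.coe_valMinAbs (x i), ← ZMod.coe_valMinAbs (y i), hi]

/-- **The periodic ℓ¹ length** ∣x∣ := Σ_i ∣x_i∣_T of a point of the torus (ℤ/T)^d — the ℓ¹ lattice distance to 0
on the periodic lattice T₁ of [Balaban1987RG1] p. 251 (*"a torus T obtained by the usual identification of
boundary points of the cube"*); used as ∣x − y∣ in (5.10). [cite: Balaban1987RG1, (0.1) p.251] -/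
def pl1 (x : TPt d T) : ℝ := l1 (vmaVec x)

/-- ∣x∣ = Σ_i ∣x_i∣_T. [folklore] -/
theorem pl1_eq_sum (x : TPt d T) : pl1 x = ∑ i, (pabs (x i) : ℝ) := by
  unfold pl1 B12Sec2to5.l1 vmaVec pabs
  simp [Int.cast_abs]

/-- ∣x∣ ≥ 0. [folklore] -/
theorem pl1_nonneg (x : TPt d T) : 0 ≤ pl1 x := l1_nonneg _

/-- `proj` is additive: proj(x − y) = proj x − proj y. [folklore] -/
theorem proj_sub (x y : Pt d) : proj T (x - y) = proj T x - proj T y := by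
  funext i
  simp [proj]

/-- proj(−x) = −proj x. [folklore] -/
theorem proj_neg (x : Pt d) : proj T (-x) = -proj T x := by
  funext i
  simp [proj]

/-- `proj ∘ vmaVec = id`: the minimal representatives project back. [folklore] -/
@[simp] theorem proj_vmaVec (x : TPt d T) : proj T (vmaVec x) = x := by
  funext i
  simp [proj, vmaVec, ZMod.coe_valMinAbs]

/-- ∣x − y∣ = ∣y − x∣. [folklore] -/
theorem pl1_sub_comm (x y : TPt d T) : pl1 (x - y) = pl1 (y - x) := by
  rw [pl1_eq_sum, pl1_eq_sum]
  exact Finset.sum_congr rfl fun i _ => by rw [Pi.sub_apply, Pi.sub_apply, pabs_sub_comm]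

variable [NeZero T]

/-- ∣x − z∣ ≤ ∣x − y∣ + ∣y − z∣. [folklore] -/
theorem pl1_sub_triangle (x y z : TPt d T) : pl1 (x - z) ≤ pl1 (x - y) + pl1 (y - z) := by
  rw [pl1_eq_sum, pl1_eq_sum, pl1_eq_sum, ← Finset.sum_add_distrib]
  refine Finset.sum_le_sum fun i _ => ?_
  have h : (x - z) i = (x - y) i + (y - z) i := by simp
  rw [h]
  exact_mod_cast pabs_add_le ((x - y) i) ((y - z) i)

/-- **Projecting never lengthens**: ∣proj z∣ ≤ ∣z∣₁ for z ∈ ℤ^d (coordinatewise minimality). [folklore] -/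
theorem pl1_proj_le_l1 (z : Pt d) : pl1 (proj T z) ≤ l1 z := by
  rw [pl1_eq_sum]
  unfold B12Sec2to5.l1
  refine Finset.sum_le_sum fun i _ => ?_
  rw [← Int.cast_abs]
  exact_mod_cast pabs_le_abs_of_cast_eq (a := proj T z i) (x := z i) rfl

/-- **Projecting is isometric on small vectors**: ∣proj z∣ = ∣z∣₁ whenever 2∣z_i∣ < T for all i. [folklore] -/
theorem pl1_proj_eq_l1 {z : Pt d} (h : ∀ i, 2 * |z i| < T) : pl1 (proj T z) = l1 z := by
  rw [pl1_eq_sum]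
  unfold B12Sec2to5.l1
  refine Finset.sum_congr rfl fun i _ => ?_
  rw [← Int.cast_abs]
  exact_mod_cast pabs_intCast_of_two_mul_abs_lt (h i)

end Sites

/-! ## 3. The torus with N·M sites per direction: cubes of side M indexed by (ℤ/N)^d -/

section FineTorus

variable {N M : ℕ} [NeZero N] [NeZero M]

/-- **The cube of a site** of the torus T₁ with N·M sites per direction: ⌊x/M⌋ mod N on the standard lift
x ∈ [0, NM)^d (p. 257: *"We decompose the space T into the lattice of closed cubes of a size M"*; the cubes of the
torus are indexed by (ℤ/N)^d as in `TreeLengthTorus.TPt`). [cite: Balaban1987RG1, §0 p.257] -/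
def tcubeOf (N M : ℕ) [NeZero N] [NeZero M] (p : TPt d (N * M)) : TPt d N := proj N (cubeOf M (natLift p))

/-- **The cube of a site does not depend on the lift**: for ANY integer lift P of the site p, ⌊P/M⌋ mod N is the
cube of p (a period N·M of the sites is a period N of the cube indices). [folklore] -/
theorem proj_cubeOf_of_proj_eq {P : Pt d} {p : TPt d (N * M)} (h : proj (N * M) P = p) :
    proj N (cubeOf M P) = tcubeOf N M p := by
  have hM : (M : ℤ) ≠ 0 := by exact_mod_cast (Nat.pos_of_neZero M).ne'
  funext i
  have h1 : ((natLift p i : ℤ) : ZMod (N * M)) = ((P i : ℤ) : ZMod (N * M)) := by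
    have := congrFun h i
    simp only [proj] at this
    rw [this]
    simp [natLift]
  obtain ⟨j, hj⟩ := exists_eq_add_mul_of_cast_eq h1
  show (((cubeOf M P) i : ℤ) : ZMod N) = (((cubeOf M (natLift p)) i : ℤ) : ZMod N)
  unfold B12Decay510Lattice.cubeOf
  have h2 : P i / (M : ℤ) = natLift p i / (M : ℤ) + j * N := by
    rw [hj, show natLift p i + j * ((N * M : ℕ) : ℤ) = natLift p i + (j * N) * (M : ℤ) by push_cast; ring,
      Int.add_mul_ediv_right _ _ hM]
  rw [h2]
  push_cast
  simp

/-- The cube of a site, read on its standard lift. [folklore] -/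
theorem tcubeOf_eq (p : TPt d (N * M)) : tcubeOf N M p = proj N (cubeOf M (natLift p)) := rfl

/-- A site of the cube c: the image of its lower corner M·c (standard lift). [folklore] -/
def base (N M : ℕ) [NeZero N] [NeZero M] (c : TPt d N) : TPt d (N * M) :=
  proj (N * M) (fun i => (M : ℤ) * natLift c i)

/-- The corner site lies in its cube: every cube of the torus has a site. [folklore] -/
theorem tcubeOf_base (c : TPt d N) : tcubeOf N M (base N M c) = c := by
  have hM : (M : ℤ) ≠ 0 := by exact_mod_cast (Nat.pos_of_neZero M).ne'
  unfold base
  rw [← proj_cubeOf_of_proj_eq (P := fun i => (M : ℤ) * natLift c i) rfl]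
  have h : cubeOf M (fun i => (M : ℤ) * natLift c i) = natLift c := by
    funext i
    show (M : ℤ) * natLift c i / (M : ℤ) = natLift c i
    rw [mul_comm, Int.mul_ediv_cancel _ hM]
  rw [h, proj_natLift]

/-- The sites of the cube c, as a finite set. [folklore] -/
def fibre (N M : ℕ) [NeZero N] [NeZero M] (c : TPt d N) : Finset (TPt d (N * M)) :=
  Finset.univ.filter fun q => tcubeOf N M q = c

/-- Membership in `fibre`. [folklore] -/
@[simp] theorem mem_fibre {c : TPt d N} {q : TPt d (N * M)} : q ∈ fibre N M c ↔ tcubeOf N M q = c := by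
  simp [fibre]

/-- Every cube has a site. [folklore] -/
theorem fibre_nonempty (c : TPt d N) : (fibre N M c).Nonempty :=
  ⟨base N M c, mem_fibre.2 (tcubeOf_base c)⟩

/-- **dist(x, □_c)**: the periodic ℓ¹ distance from the site x to the cube c (the minimum over the sites of the cube).
[cite: Balaban1987RG1, §0 p.257] -/
def distCT (N M : ℕ) [NeZero N] [NeZero M] (p : TPt d (N * M)) (c : TPt d N) : ℝ :=
  (fibre N M c).inf' (fibre_nonempty c) fun q => pl1 (p - q)

/-- dist(x, □_c) ≤ ∣x − q∣ for every site q of the cube c. [folklore] -/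
theorem distCT_le {p q : TPt d (N * M)} {c : TPt d N} (hq : tcubeOf N M q = c) : distCT N M p c ≤ pl1 (p - q) :=
  Finset.inf'_le _ (mem_fibre.2 hq)

/-- dist(x, □_c) is attained at a site of the cube. [folklore] -/
theorem exists_distCT_eq (p : TPt d (N * M)) (c : TPt d N) :
    ∃ q, tcubeOf N M q = c ∧ pl1 (p - q) = distCT N M p c := by
  obtain ⟨q, hq, h⟩ := Finset.exists_mem_eq_inf' (fibre_nonempty c) fun q => pl1 (p - q)
  exact ⟨q, mem_fibre.1 hq, h.symm⟩

/-- dist(x, □_c) ≥ 0. [folklore] -/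
theorem distCT_nonneg (p : TPt d (N * M)) (c : TPt d N) : 0 ≤ distCT N M p c := by
  obtain ⟨q, -, h⟩ := exists_distCT_eq p c
  rw [← h]
  exact pl1_nonneg _

omit [NeZero N] in
/-- Cube indices are 1-Lipschitz in the sites: ∣⌊P/M⌋ − ⌊Q/M⌋∣₁ ≤ ∣P − Q∣₁ on ℤ^d (M ≥ 1). [folklore] -/
theorem l1_cubeOf_sub_cubeOf_le (P Q : Pt d) : l1 (cubeOf M P - cubeOf M Q) ≤ l1 (P - Q) := by
  have hM : 0 < M := Nat.pos_of_neZero M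
  unfold B12Sec2to5.l1
  refine Finset.sum_le_sum fun i _ => ?_
  rw [Pi.sub_apply, Pi.sub_apply]
  have h1 := abs_cubeOf_sub_le_distI hM P (cubeOf M Q) i
  have h2 := distI_le_abs_sub (mem_cube_cubeOf hM Q i).1 (mem_cube_cubeOf hM Q i).2 (P i)
  exact_mod_cast h1.trans h2

/-- **Key lower bound**: dist(x, □_c) ≥ ∣cube(x) − c∣ (periodic ℓ¹ distance of the cube indices on (ℤ/N)^d) —
re-lift the nearest site q of □_c next to the standard lift of x; the cube indices of the two lifts are within
∣x − q∣ of each other and project to cube(x), c. [folklore] -/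
theorem pl1_tcubeOf_sub_le_distCT (p : TPt d (N * M)) (c : TPt d N) :
    pl1 (tcubeOf N M p - c) ≤ distCT N M p c := by
  obtain ⟨q, hq, h⟩ := exists_distCT_eq p c
  rw [← h, ← hq]
  -- re-lift p next to the standard lift of q
  set P' : Pt d := natLift q + vmaVec (p - q) with hP'
  have hP'proj : proj (N * M) P' = p := by
    have h1 : proj (N * M) P' = proj (N * M) (natLift q) + proj (N * M) (vmaVec (p - q)) := by
      funext i; simp only [proj, hP', Pi.add_apply, Int.cast_add]
    rw [h1, proj_natLift, proj_vmaVec, add_sub_cancel]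
  have hp : tcubeOf N M p = proj N (cubeOf M P') := (proj_cubeOf_of_proj_eq hP'proj).symm
  rw [hp, tcubeOf_eq, ← proj_sub]
  calc pl1 (proj N (cubeOf M P' - cubeOf M (natLift q)))
      ≤ l1 (cubeOf M P' - cubeOf M (natLift q)) := pl1_proj_le_l1 _
    _ ≤ l1 (P' - natLift q) := l1_cubeOf_sub_cubeOf_le _ _
    _ = pl1 (p - q) := by rw [hP', add_sub_cancel_left]; rfl

/-- **The lift-free diameter bound on cube indices**: for two cubes a, b of a torus localization domain X̄ and every
coordinate i, ∣a_i − b_i∣_N ≤ d_j(X̄) + 2 — every admissible graph of the universal cover meets SOME lift of each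
cube (`TAdmissible.meets`), the two meeting points are within its length (`dist_le_len`), each unit cube adds 1,
and the difference of the two lifts represents a_i − b_i (minimality of ∣·∣_N).  (Locus of the DEFINITION of d_j:
p.257; the bound is derived here, not printed.) [folklore] -/
theorem pabs_sub_le_torusTreeLen {X : Finset (TPt d N)} (hX : X.Nonempty) (hc : TFaceConnected X)
    {a b : TPt d N} (ha : a ∈ X) (hb : b ∈ X) (i : Fin d) :
    (pabs (a i - b i) : ℝ) ≤ torusTreeLen X + 2 := by
  obtain ⟨T₀, hT₀, -⟩ := exists_tAdmissible hX hc
  have h := le_torusTreeLen (a := (pabs (a i - b i) : ℝ) - 2) ⟨T₀, hT₀⟩ fun T hT => by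
    obtain ⟨x, hxa, p, hpT, hpx⟩ := hT.meets a ha
    obtain ⟨y, hyb, q, hqT, hqy⟩ := hT.meets b hb
    have h1 : dist (corner x) p ≤ 1 := dist_le_one_of_mem_cube (corner_mem_cube x) hpx
    have h2 : dist q (corner y) ≤ 1 := dist_le_one_of_mem_cube hqy (corner_mem_cube y)
    have h3 : dist p q ≤ len T := dist_le_len hT.connected.isPreconnected hpT hqT
    have h4 := dist_triangle4 (corner x) p q (corner y)
    have h5 : (|((x i - y i : ℤ) : ℝ)|) ≤ dist (corner x) (corner y) := by
      have := dist_le_pi_dist (corner x) (corner y) i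
      rw [Real.dist_eq] at this
      simpa [corner, Int.cast_sub] using this
    have h6 : (pabs (a i - b i) : ℝ) ≤ |((x i - y i : ℤ) : ℝ)| := by
      rw [← Int.cast_abs]
      have hrep : (((x i - y i : ℤ)) : ZMod N) = a i - b i := by
        have hx := congrFun hxa i
        have hy := congrFun hyb i
        simp only [proj] at hx hy
        push_cast
        rw [hx, hy]
      exact_mod_cast pabs_le_abs_of_cast_eq hrep
    linarith
  linarith

/-- **Site-level diameter of a torus localization domain**: ∣p − q∣ ≤ Md(d_j(X̄) + 3) for sites p, q lying in
cubes of X̄ (periodic ℓ¹ distance; cube indices within d_j + 2 per coordinate by `pabs_sub_le_torusTreeLen`, then a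
coordinatewise RE-LIFTING of q so that the lifted cube indices differ by exactly the minimal representatives, and
the lattice module's `l1_sub_le_of_cubeOf`).  Same slots (M·d, c₁ = 3) as `B12Decay510Lattice.l1_sub_le_treeLen_sites`.
[folklore] -/
theorem pl1_sub_le_torusTreeLen_sites {X : Finset (TPt d N)} (hX : X.Nonempty) (hc : TFaceConnected X)
    {p q : TPt d (N * M)} (hp : tcubeOf N M p ∈ X) (hq : tcubeOf N M q ∈ X) :
    pl1 (p - q) ≤ (M : ℝ) * d * (torusTreeLen X + 3) := by
  have hM : 0 < M := Nat.pos_of_neZero M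
  have hMz : (M : ℤ) ≠ 0 := by exact_mod_cast hM.ne'
  set a := tcubeOf N M p with ha
  set b := tcubeOf N M q with hb
  set s : Pt d := vmaVec (a - b) with hs
  set P : Pt d := natLift p with hP
  set Q : Pt d := natLift q with hQ
  -- the cube indices of the standard lifts represent a, b
  have hA : proj N (cubeOf M P) = a := rfl
  have hB : proj N (cubeOf M Q) = b := rfl
  -- coordinatewise: A i - B i ≡ s i (mod N)
  have hrep : ∀ i, ∃ t : ℤ, cubeOf M P i - cubeOf M Q i = s i + t * N := by
    intro i
    have h1 : (((s i : ℤ)) : ZMod N) = (((cubeOf M P i - cubeOf M Q i : ℤ)) : ZMod N) := by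
      have hAi := congrFun hA i
      have hBi := congrFun hB i
      simp only [proj] at hAi hBi
      push_cast
      rw [hAi, hBi]
      simp [hs, vmaVec, ZMod.coe_valMinAbs]
    obtain ⟨t, ht⟩ := exists_eq_add_mul_of_cast_eq h1
    exact ⟨t, by linarith⟩
  choose t ht using hrep
  -- the re-lifted q
  set Q' : Pt d := fun i => Q i + t i * N * M with hQ'
  have hQ'cube : ∀ i, cubeOf M Q' i = cubeOf M Q i + t i * N := by
    intro i
    show (Q i + t i * N * M) / (M : ℤ) = Q i / (M : ℤ) + t i * N
    rw [show Q i + t i * N * M = Q i + (t i * N) * (M : ℤ) by ring, Int.add_mul_ediv_right _ _ hMz]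
  have hdiff : cubeOf M P - cubeOf M Q' = s := by
    funext i
    rw [Pi.sub_apply, hQ'cube i]
    have := ht i
    linarith
  have hQ'proj : proj (N * M) Q' = q := by
    funext i
    have h0 : (((t i * N * M : ℤ)) : ZMod (N * M)) = 0 := by
      rw [show (t i * N * M : ℤ) = t i * ((N * M : ℕ) : ℤ) by push_cast; ring, Int.cast_mul, Int.cast_natCast,
        ZMod.natCast_self, mul_zero]
    have hqi := congrFun (proj_natLift (N := N * M) q) i
    simp only [proj] at hqi ⊢
    rw [show Q' i = Q i + t i * N * M from rfl, Int.cast_add, h0, add_zero, hQ]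
    exact hqi
  have hPproj : proj (N * M) P = p := proj_natLift p
  -- ∣p − q∣ ≤ ∣P − Q'∣₁ ≤ M∣s∣₁ + d(M − 1)
  have h1 : pl1 (p - q) ≤ l1 (P - Q') := by
    rw [← hPproj, ← hQ'proj, ← proj_sub]
    exact pl1_proj_le_l1 _
  have h2 := l1_sub_le_of_cubeOf hM P Q'
  rw [hdiff] at h2
  -- ∣s∣₁ ≤ d (d_j + 2)
  have h3 : l1 s ≤ d * (torusTreeLen X + 2) := by
    unfold B12Sec2to5.l1
    calc ∑ i, |((s i : ℤ) : ℝ)| ≤ ∑ _i : Fin d, (torusTreeLen X + 2) := Finset.sum_le_sum fun i _ => by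
            rw [← Int.cast_abs]
            have : |s i| = pabs (a i - b i) := by simp [hs, vmaVec, pabs]
            rw [this]
            exact pabs_sub_le_torusTreeLen hX hc hp hq i
      _ = d * (torusTreeLen X + 2) := by
            simp only [Finset.sum_const, Finset.card_univ, Fintype.card_fin, nsmul_eq_mul]
  have hM0 : (0 : ℝ) ≤ M := Nat.cast_nonneg M
  have hd0 : (0 : ℝ) ≤ d := Nat.cast_nonneg d
  have h4 := mul_le_mul_of_nonneg_left h3 hM0
  nlinarith [h1, h2, h4, hd0, hM0]

omit [NeZero M] in
/-- **The unit-cube sum on the torus is dominated by the one on ℤ^d**: Σ_{w ∈ (ℤ/N)^d} e^{−a∣w∣} ≤ Σ_{z ∈ ℤ^d} e^{−a∣z∣₁}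
= K₁(d, a) for a > 0 (the minimal representatives embed (ℤ/N)^d into ℤ^d isometrically for ∣·∣). [folklore] -/
theorem sum_exp_pl1_le_K₁ {a : ℝ} (ha : 0 < a) : ∑ w : TPt d N, Real.exp (-a * pl1 w) ≤ K₁ d a := by
  classical
  have hs := B12Sec2to5.summable_exp_neg_l1 ha d
  have h1 : ∑ w : TPt d N, Real.exp (-a * pl1 w) =
      ∑ z ∈ (Finset.univ : Finset (TPt d N)).image vmaVec, Real.exp (-a * l1 z) := by
    rw [Finset.sum_image fun x _ y _ h => vmaVec_injective h]
    rfl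
  rw [h1]
  exact hs.sum_le_tsum _ fun z _ => (Real.exp_pos _).le

/-- **The cube sum on the torus with an M-uniform constant**: Σ_{□ ∈ π_j} e^{−a·dist(x, □)} ≤ K₁(d, a) for every site
x and a > 0 (`pl1_tcubeOf_sub_le_distCT` and re-indexing □ ↦ cube(x) − □). [cite: Balaban1987RG1, (5.10) p.293] -/
theorem sum_exp_distCT_le (p : TPt d (N * M)) {a : ℝ} (ha : 0 < a) :
    ∑ c : TPt d N, Real.exp (-a * distCT N M p c) ≤ K₁ d a := by
  have h1 : ∑ c : TPt d N, Real.exp (-a * distCT N M p c) ≤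
      ∑ c : TPt d N, Real.exp (-a * pl1 (tcubeOf N M p - c)) :=
    Finset.sum_le_sum fun c _ => Real.exp_le_exp.2 (by nlinarith [pl1_tcubeOf_sub_le_distCT p c, ha.le])
  have h2 : ∑ c : TPt d N, Real.exp (-a * pl1 (tcubeOf N M p - c)) = ∑ w : TPt d N, Real.exp (-a * pl1 w) :=
    Fintype.sum_equiv (Equiv.subLeft (tcubeOf N M p)) _ _ fun c => rfl
  exact h1.trans (h2 ▸ sum_exp_pl1_le_K₁ ha)

/-! ## 4. The `SiteGeometry` of the torus and its three leaves -/

/-- A cube of the torus domain X̄ nearest to the site x exists (X̄ is a non-empty finite family). [folklore] -/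
theorem exists_nearT (p : TPt d (N * M)) (X : TDom d N) :
    ∃ c ∈ X.1, ∀ c' ∈ X.1, distCT N M p c ≤ distCT N M p c' :=
  Finset.exists_min_image X.1 (fun c => distCT N M p c) X.2.1

/-- A chosen cube of X̄ nearest to the site x. [folklore] -/
def nearT (p : TPt d (N * M)) (X : TDom d N) : TPt d N :=
  Classical.choose (exists_nearT (M := M) p X)

/-- The nearest cube belongs to the domain. [folklore] -/
theorem nearT_mem (p : TPt d (N * M)) (X : TDom d N) : nearT (M := M) p X ∈ X.1 :=
  (Classical.choose_spec (exists_nearT (M := M) p X)).1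

/-- The nearest cube minimizes the distance. [folklore] -/
theorem nearT_le (p : TPt d (N * M)) (X : TDom d N) {c : TPt d N} (hc : c ∈ X.1) :
    distCT N M p (nearT (M := M) p X) ≤ distCT N M p c :=
  (Classical.choose_spec (exists_nearT (M := M) p X)).2 c hc

/-- **THE `SiteGeometry` OF THE TORUS** (p. 251 torus; p. 257: cubes of side M, localization domains = unions of
cubes; p. 282 / (5.10): dist(X, ·) and ∣x − y∣ between sites) over the periodic cube system
`TreeLengthTorus.tcubeSys d N` (cubes (ℤ/N)^d, domains = non-empty torus-face-connected families, d_j := `torusTreeLen`):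
sites := the torus (ℤ/NM)^d, dist(x, □) := the periodic ℓ¹ distance from the site to the cube, dist(x, X̄) := min
over the cubes of X̄, `pick x X̄` := a nearest cube.  CONSTRUCTED; no field is a hypothesis.
[cite: Balaban1987RG1, §0 p.257] -/
def geomT (d N M : ℕ) [NeZero N] [NeZero M] : SiteGeometry (tcubeSys d N).toCubeCover (TPt d (N * M)) where
  distC := fun p c => distCT N M p c
  distD := fun p X => distCT N M p (nearT (M := M) p X)
  distC_nonneg := fun p c => distCT_nonneg p c
  distD_nonneg := fun p X => distCT_nonneg p _
  pick := fun p X => nearT (M := M) p X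
  pick_mem := fun p X => by
    show X ∈ (tcubeSys d N).above _
    rw [CubeSystem.mem_above]
    exact nearT_mem p X
  distC_pick_le := fun _ _ => le_rfl

/-- dist(x, X̄) of the torus geometry, unfolded. [folklore] -/
@[simp] theorem geomT_distD (p : TPt d (N * M)) (X : TDom d N) :
    (geomT d N M).distD p X = distCT N M p (nearT (M := M) p X) := rfl

/-- dist(x, □) of the torus geometry, unfolded. [folklore] -/
@[simp] theorem geomT_distC (p : TPt d (N * M)) (c : TPt d N) :
    (geomT d N M).distC p c = distCT N M p c := rfl

/-- **Leaf (b), the geometry leaf, PROVED on the torus**: ∣x − y∣ ≤ dist(x, X̄) + dist(y, X̄) + Md(d_j(X̄) + 3) in the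
periodic ℓ¹ distance (`B12Decay510.geomLeaf_of_diam` on `pl1_sub_le_torusTreeLen_sites`, the nearest points being
nearest sites of the nearest cubes). [cite: Balaban1987RG1, §0 p.257] -/
theorem geomLeafT (d N M : ℕ) [NeZero N] [NeZero M] :
    GeomLeaf (geomT d N M) (fun x y => pl1 (x - y)) ((M : ℝ) * d) 3 := by
  refine geomLeaf_of_diam (geomT d N M) (fun p (X : TDom d N) => tcubeOf N M p ∈ X.1)
    (fun x y => pl1_sub_comm x y) (fun x y z => pl1_sub_triangle x y z)
    (fun X p q hp hq => pl1_sub_le_torusTreeLen_sites X.2.1 X.2.2 hp hq) fun x X => ?_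
  obtain ⟨q, hq, h⟩ := exists_distCT_eq (N := N) (M := M) x (nearT (M := M) x X)
  exact ⟨q, hq ▸ nearT_mem x X, by rw [geomT_distD, ← h]⟩

/-- **Leaf (c), the cube-sum leaf, PROVED on the torus with an (M, N)-uniform constant**:
Σ_□ e^{−a·dist(x, □)} ≤ K₁(d, a) for a > 0 (`sum_exp_distCT_le`). [cite: Balaban1987RG1, (5.10) p.293] -/
theorem cubeSumLeafT (d N M : ℕ) [NeZero N] [NeZero M] {a : ℝ} (ha : 0 < a) :
    CubeSumLeaf (geomT d N M) a (K₁ d a) :=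
  fun p => sum_exp_distCT_le p ha

omit [NeZero M] in
/-- **Leaf (d), the domain-sum (tree) leaf, on the torus** — `B12Decay510.treeLeaf_of_volumeLeaf` on the degree bound
and the volume leaf PROVED in `TreeLengthTorus` (`tdegreeLE`, `tvolumeLeaf`): Σ_{X̄∋□} e^{−(κ/2)d_j(X̄)} ≤ K₀(4·2ᵈ, 2d)
once κ/2 ≥ κ₀(4·2ᵈ, 2d) — the same numbers as the window model (`B12Decay510Window.treeLeaf`).
[cite: Balaban1987RG1, (0.25)–(0.26) p.257] [cite: Balaban1988RG2Cluster, (1.26) p.8] -/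
theorem treeLeafT (d N : ℕ) [NeZero N] {κ : ℝ} (hκ : kappa₀ (4 * 2 ^ d) (2 * d) ≤ κ / 2) :
    TreeLeaf (tcubeSys d N).toCubeCover (κ / 2) (K₀ (4 * 2 ^ d) (2 * d)) :=
  treeLeaf_of_volumeLeaf (tcubeSys d N) (tdegreeLE d N) (tvolumeLeaf d N) hκ

/-! ## 5. (5.10) on the torus, every geometric leaf discharged -/

/-- **(5.10) on ONE TORUS at the resolution of print** (sites = the points of the periodic lattice T₁ with N·M sites per
direction, cubes of side M, localization domains = torus-face-connected unions of cubes, d_j := `torusTreeLen`): with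
the terms analytic on the (4.4)-ball and bounded by E₀e^{−κd_j(X̄)} there ((1.18)), the kernel = the real part of the
mixed τ-derivative on the pair of minimizer responses ((4.35)), the responses bounded by B₃e^{−δ₀dist(x, X̄)} (p. 282),
δ₀ > 0 and κ ≥ 2κ₀(4·2ᵈ, 2d):
∣Σ_X̄ 𝐄^{(2)}(X̄, x, y)∣ ≤ 4E₀α₂⁻²B₃² e^{3Mdδ₁} K₀ K₁(δ₀/2) e^{−δ₁∣x − y∣}, δ₁ = ½ min{δ₀, κ(Md)⁻¹}, ∣x − y∣ the periodic
ℓ¹ distance. [cite: Balaban1987RG1, (5.10) p.293] -/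
theorem abs_twoPoint_le_torus (hd : 0 < d) (N M : ℕ) [NeZero N] [NeZero M] {W : Type*}
    [NormedAddCommGroup W] [NormedSpace ℂ W] (EX : TDom d N → W → ℂ) (h : TDom d N → TPt d (N * M) → W)
    (E2 : TDom d N → TPt d (N * M) → TPt d (N * M) → ℝ) {α₂ E₀ B₃ κ δ₀ : ℝ} (hα₂ : 0 < α₂) (hE₀ : 0 ≤ E₀)
    (hB₃ : 0 ≤ B₃) (hδ₀ : 0 < δ₀) (hκ : kappa₀ (4 * 2 ^ d) (2 * d) ≤ κ / 2)
    (han : ∀ X, AnalyticOnNhd ℂ (EX X) (ball 0 α₂))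
    (h118 : ∀ X, ∀ v ∈ ball (0 : W) α₂, ‖EX X v‖ ≤ E₀ * Real.exp (-κ * torusTreeLen X.1))
    (hrepr : ∀ X x y, E2 X x y = (mixedDeriv (EX X) (h X x) (h X y)).re)
    (hh : ∀ X x, ‖h X x‖ ≤ B₃ * Real.exp (-δ₀ * distCT N M x (nearT (M := M) x X))) (x y : TPt d (N * M)) :
    |∑ X : TDom d N, E2 X x y| ≤ 4 * E₀ / α₂ ^ 2 * B₃ ^ 2 * Real.exp (delta1 δ₀ κ ((M : ℝ) * d) * ((M : ℝ) * d) * 3) *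
      K₀ (4 * 2 ^ d) (2 * d) * K₁ d (δ₀ / 2) * Real.exp (-(delta1 δ₀ κ ((M : ℝ) * d)) * pl1 (x - y)) := by
  have hκ0 : 0 ≤ κ := by
    have := kappa₀_nonneg (c₀ := 4 * 2 ^ d) (by positivity) (2 * d)
    linarith
  have hMd : (0 : ℝ) < (M : ℝ) * d := mul_pos (Nat.cast_pos.2 (Nat.pos_of_neZero M)) (Nat.cast_pos.2 hd)
  exact abs_twoPoint_le_of_analytic (S := tsys d N) (geomT d N M) (ρ := fun x y => pl1 (x - y)) EX h E2 hα₂ hE₀ hB₃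
    (K₀_pos _ _).le hδ₀.le hκ0 hMd han h118 hrepr hh (geomLeafT d N M) (cubeSumLeafT d N M (half_pos hδ₀))
    (treeLeafT d N hκ) x y

end FineTorus

/-! ## 6. The exhausting family of tori T₁ ↗ ℤ^d and `B12Sec2to5.Decay510` -/

section Family

variable {M : ℕ} [NeZero M]

/-- **The metric leaf on growing tori**: the embeddings z ↦ z mod N_nM of ℤ^d into the tori are isometric at the pair
(0, z) as soon as N_n·M > 2∣z∣_∞ — eventually, for N_n → ∞ (the limit *"T₁^{(j)} ↗ Z^d"* of (5.1)).
[cite: Balaban1987RG1, (5.1) p.292] -/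
theorem pl1_proj_zero_sub_proj_eventually (N : ℕ → ℕ) [∀ n, NeZero (N n)] (hN : Tendsto N atTop atTop)
    (z : Pt d) : ∀ᶠ n in atTop, pl1 (proj (N n * M) 0 - proj (N n * M) z) = l1 z := by
  have hB : ∀ i, 2 * |z i| ≤ 2 * ∑ j, |z j| := fun i =>
    mul_le_mul_of_nonneg_left (Finset.single_le_sum (fun j _ => abs_nonneg (z j)) (Finset.mem_univ i)) (by norm_num)
  filter_upwards [hN.eventually_gt_atTop (2 * ∑ j, |z j|).toNat] with n hn
  have hM : 1 ≤ M := Nat.pos_of_neZero M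
  have hn' : 2 * ∑ j, |z j| < ((N n * M : ℕ) : ℤ) := by
    have h1 : 2 * ∑ j, |z j| < (N n : ℤ) := (Int.self_le_toNat _).trans_lt (by exact_mod_cast hn)
    have h2 : (N n : ℤ) ≤ ((N n * M : ℕ) : ℤ) := by
      push_cast
      exact le_mul_of_one_le_right (by positivity) (by exact_mod_cast hM)
    exact h1.trans_le h2
  rw [← proj_sub, zero_sub, pl1_proj_eq_l1 (fun i => by rw [Pi.neg_apply, abs_neg]; exact (hB i).trans_lt hn'),
    l1_neg]

/-- **(5.10) = `B12Sec2to5.Decay510` ON THE PERIODIC CARRIER OF PRINT, every geometric leaf discharged**: an exhausting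
family of tori T₁ with N_n·M sites per direction, N_n → ∞ (cubes of side M ≥ 1, sites the torus points), the analytic
hypotheses of `B12Decay510Window.decay510_window` on each torus (the minimizer decay in the periodic distance from the
SITE to the domain), and the limit (5.1) *"lim_{T₁^{(j)} ↗ Z^d}"* at the sites 0, z mod N_nM ⇒
`Decay510 P (4E₀α₂⁻²B₃² e^{3Mdδ₁} K₀(4·2ᵈ,2d) K₁(d, δ₀/2)) δ₁`, δ₁ = `delta1 δ₀ κ (M·d)` = ½ min{δ₀, κ(Md)⁻¹} — the SAME
constants as the window/lattice version `B12Decay510Lattice.decay510_lattice`. [cite: Balaban1987RG1, (5.1) p.292 and (5.10) p.293] -/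
theorem decay510_torus (hd : 0 < d) (N : ℕ → ℕ) [∀ n, NeZero (N n)] (hN : Tendsto N atTop atTop)
    (Wn : ℕ → Type*) [∀ n, NormedAddCommGroup (Wn n)] [∀ n, NormedSpace ℂ (Wn n)]
    (EXn : (n : ℕ) → TDom d (N n) → Wn n → ℂ) (hn : (n : ℕ) → TDom d (N n) → TPt d (N n * M) → Wn n)
    (E2n : (n : ℕ) → TDom d (N n) → TPt d (N n * M) → TPt d (N n * M) → ℝ) (P : Pt d → ℝ) {α₂ E₀ B₃ κ δ₀ : ℝ}
    (hα₂ : 0 < α₂) (hE₀ : 0 ≤ E₀) (hB₃ : 0 ≤ B₃) (hδ₀ : 0 < δ₀) (hκ : kappa₀ (4 * 2 ^ d) (2 * d) ≤ κ / 2)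
    (han : ∀ n X, AnalyticOnNhd ℂ (EXn n X) (ball 0 α₂))
    (h118 : ∀ n X, ∀ v ∈ ball (0 : Wn n) α₂, ‖EXn n X v‖ ≤ E₀ * Real.exp (-κ * torusTreeLen X.1))
    (hrepr : ∀ n X x y, E2n n X x y = (mixedDeriv (EXn n X) (hn n X x) (hn n X y)).re)
    (hh : ∀ n X x, ‖hn n X x‖ ≤ B₃ * Real.exp (-δ₀ * distCT (N n) M x (nearT (M := M) x X)))
    (hlim : ∀ z, Tendsto (fun n => ∑ X : TDom d (N n), E2n n X (proj (N n * M) 0) (proj (N n * M) z)) atTop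
      (𝓝 (P z))) :
    B12Sec2to5.Decay510 P (4 * E₀ / α₂ ^ 2 * B₃ ^ 2 * Real.exp (delta1 δ₀ κ ((M : ℝ) * d) * ((M : ℝ) * d) * 3) *
      K₀ (4 * 2 ^ d) (2 * d) * K₁ d (δ₀ / 2)) (delta1 δ₀ κ ((M : ℝ) * d)) := by
  have hκ0 : 0 ≤ κ := by
    have := kappa₀_nonneg (c₀ := 4 * 2 ^ d) (by positivity) (2 * d)
    linarith
  have hMd : (0 : ℝ) < (M : ℝ) * d := mul_pos (Nat.cast_pos.2 (Nat.pos_of_neZero M)) (Nat.cast_pos.2 hd)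
  exact decay510_of_analytic_leaves (fun n => tsys d (N n)) (fun n => (tcubeSys d (N n)).toCubeCover)
    (fun n => TPt d (N n * M)) (fun n => geomT d (N n) M) (fun _ x y => pl1 (x - y)) Wn EXn hn E2n
    (fun n z => proj (N n * M) z) P hα₂ hE₀ hB₃ (K₀_pos _ _).le hδ₀.le hκ0 hMd han h118 hrepr hh
    (fun n => geomLeafT d (N n) M) (fun n => cubeSumLeafT d (N n) M (half_pos hδ₀)) (fun n => treeLeafT d (N n) hκ)
    (pl1_proj_zero_sub_proj_eventually N hN) hlim

end Family

end

end Literature.MathematicalPhysics.QuantumFieldTheory.Balaban1983to89.B12Decay510Torus
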